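import Literature.MathematicalPhysics.QuantumLattice.HubbardUVSymbolSurfaceDifferences
import Literature.MathematicalPhysics.QuantumLattice.HubbardUVSymbolCTDifferences
import Literature.MathematicalPhysics.QuantumLattice.MatsubaraShiftedEnvelopeSums
import HarnessLib

/-!
# MIXED differences `Δ_u^a Δ_{e_l}^b Δ_{e_l'}^c` of the padded ultraviolet symbol of the counterterm carrier on the space–time dual torus
# `(ℤ/N) × (ℤ/L)²` — the `ℓ²` inputs of the FIRST MOMENTS of the scale-`0` covariance, uniform in `M`, `β`, `L`

Topic `MathematicalPhysics/QuantumLattice`; continues `HubbardUVSymbolCTDifferences` (cell gate-hubbard-kl).  There: the pure second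
differences (two in time OR two along one lattice line) of `G = gridSymbol L M N β (uvSymbolCT L M β μ K Λ) σ`, the padded symbol
`(βL²)⁻² Ψ_{e_K(q⃗)}(ω̃_{q₀})·[val q₀ < 2M]` of the covariance `C^K_{>Λ}` of the counterterm carrier in a frame `K`.  The first moments of
that covariance in every space-time direction with a PRODUCT weight (Benfatto–Giuliani–Mastropietro 2006, Lemma 2.2;
`TorusFourierWeightedL1Mixed.sum_sum_mixedWeight_mul_norm_sq_le`) are paid by the `ℓ²` norms of the MIXED differences
`Δ_u^a (Δ_{e_l}^b Δ_{e_l'}^c G(q₀, ·))(q⃗)` — `a` time differences (`u = 1 ∈ ℤ/N`), `b, c ≤ 1` differences along the unit vectors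
`e_l, e_{l'}` of `(ℤ/L)²` (`l = l'` is the pure second space difference).  Here, for EVERY time order `a` with `a + 1 ≤ M`:
(i) in the INTERIOR `val q₀ + a < 2M` the grid function samples the normalised continuum symbol `Ψ₁(ω, e_K(p + s e_l + t e_{l'}))`
(`uvSymbolOneFn`, `ctSurface`; `mixedDiff_gridSymbol_eq_interior`), so `HubbardUVSymbolSurfaceDifferences.norm_mixedDiff_uvSymbolOneFn_le`
gives `(βL²)⁻¹(2π/β)^a(2π/L)^{b+c}·S_{a,b+c}/max(|ω̃| - 2πa/β, Λ/2)^{a+min(b+c,1)+1}` under `UVSurfaceBound μ K D` (the band along two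
lattice directions has `∂_s, ∂_t, ∂_s∂_t` bounded by `D`; discharged from `FrameOK` Summits-side); (ii) in the PADDING the differences
vanish; (iii) at the `≤ 2a` EDGE points every sample is padding or at a frequency `|ω̃| ≥ π(2M - 2a + 1)/β`, so the difference is `2^a`
times the `a = 0` bound there; (iv) the Matsubara sums of the shifted envelopes are uniform in `M`:
`Σ_i max(|ω_i| - 2πa/β, Λ/2)^{-2n} ≤ 4ⁿ(2/Λ)^{2n-2}·2β/Λ + 4a·(2/Λ)^{2n}`.

* `ctSurface`, `UVSurfaceBound`, `nambuXiCT_add_smul_add_smul_eq_ctSurface`;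
* `gridSymbol_uvSymbolCT_translate`, **`mixedDiff_gridSymbol_eq_interior`**, **`norm_mixedDiff_gridSymbol_le_interior`**;
* `mixedDiff_gridSymbol_eq_zero_of_padding`, `abs_gridFreq_ge_of_extreme`, **`norm_mixedDiff_gridSymbol_le_edge`**, `card_timeEdge_le`;
* (`MatsubaraShiftedEnvelopeSums.sum_inv_uvEnvShift_pow_le` supplies the shifted-envelope Matsubara sums);
* **`sum_norm_sq_mixedDiff_uvSymbolCT_le`** (the export, in the shape of `sum_sum_mixedWeight_mul_norm_sq_le`'s right-hand side).

Everything is proved; `ctSurface` and `UVSurfaceBound` are the only definitions; no named facts.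

## Sources

G. Benfatto, A. Giuliani, V. Mastropietro, Ann. Henri Poincaré 7 (2006) 809–898, §2.1 (2.3), Lemma 2.2, (2.36aa), footnote ¹, App. A1
(`BenfattoGiulianiMastropietro2006`); M. Salmhofer, *Renormalization* (1999), §4.2.4–4.2.5 (4.63), (4.70) (`Salmhofer1999`);
J. Feldman, M. Salmhofer, E. Trubowitz, J. Stat. Phys. 84 (1996) 1209–1336, §1 (`FeldmanSalmhoferTrubowitz1996`).
-/

noncomputable section

namespace Literature.MathematicalPhysics.QuantumLattice

open Literature.Probability.LatticeModels Literature.Analysis.SpecialFunctions Finset Complex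

variable {L M N : ℕ}

/-! ### The frame band along two lattice directions -/

/-- **The frame band along two lattice directions through `p`**: `E(s,t) = e_K(p + s e_l + t e_{l'})` (`l = l'` allowed).
[cite: FeldmanSalmhoferTrubowitz1996, §1 Discussion (E = e + K)] -/
def ctSurface (μ : ℝ) (K : TrigPolyC4v) (p : Fin 2 → ℝ) (l l' : Fin 2) (s t : ℝ) : ℝ :=
  ctBandFn μ K (p + s • Pi.single l 1 + t • Pi.single l' 1)

/-- **Bounded band geometry along pairs of lattice directions** (discharged from `FrameOK` Summits-side, `‖De_K‖, ‖D²e_K‖ ≤ 7`): for every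
base point and every pair of directions the surface `E(s,t)` has partials `E_s, E_t` and the mixed partial `∂_t E_s` everywhere, all bounded
by `D`. [cite: FeldmanSalmhoferTrubowitz1998, Lemma 2.1 and eqs. (gzerinit), (wz) (arXiv p.8 L38–41, p.9 L1–75)] -/
def UVSurfaceBound (μ : ℝ) (K : TrigPolyC4v) (D : ℝ) : Prop :=
  ∀ (p : Fin 2 → ℝ) (l l' : Fin 2), ∃ Es Et Est : ℝ → ℝ → ℝ,
    (∀ s t, HasDerivAt (fun s' => ctSurface μ K p l l' s' t) (Es s t) s) ∧
    (∀ s t, HasDerivAt (fun t' => ctSurface μ K p l l' s t') (Et s t) t) ∧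
    (∀ s t, HasDerivAt (fun t' => Es s t') (Est s t) t) ∧
    ∀ s t, |Es s t| ≤ D ∧ |Et s t| ≤ D ∧ |Est s t| ≤ D

/-- **Translating a torus momentum by `j e_l + m e_{l'}` evaluates the surface**:
`e_K(k⃗ + j e_l + m e_{l'}) = E_{p(k⃗),l,l'}(j·2π/L, m·2π/L)` (periodicity of the band). [cite: BenfattoGiulianiMastropietro2006, §2.1 (2.1)] -/
theorem nambuXiCT_add_smul_add_smul_eq_ctSurface [NeZero L] (μ : ℝ) (K : TrigPolyC4v) (k : TorusSite 2 L) (l l' : Fin 2) (j m : ℕ) :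
    nambuXiCT L μ K (k + j • (Pi.single l (1 : ZMod L) : TorusSite 2 L) + m • (Pi.single l' (1 : ZMod L) : TorusSite 2 L)) =
      ctSurface μ K (latticeMomentum L k) l l' (j * (2 * Real.pi / L)) (m * (2 * Real.pi / L)) := by
  obtain ⟨z₁, hz₁⟩ := latticeMomentum_add_smul_single_eq (k + j • (Pi.single l (1 : ZMod L) : TorusSite 2 L)) l' m
  obtain ⟨z₂, hz₂⟩ := latticeMomentum_add_smul_single_eq k l j
  rw [nambuXiCT_eq_ctBandFn, hz₁, ctBandFn_periodic]
  have h2 : latticeMomentum L (k + j • (Pi.single l (1 : ZMod L) : TorusSite 2 L)) +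
      (m * (2 * Real.pi / L)) • (Pi.single l' (1 : ℝ) : Fin 2 → ℝ) =
      fun i => (latticeMomentum L k + (j * (2 * Real.pi / L)) • (Pi.single l (1 : ℝ) : Fin 2 → ℝ) +
        (m * (2 * Real.pi / L)) • (Pi.single l' (1 : ℝ) : Fin 2 → ℝ)) i + z₂ i * (2 * Real.pi) := by
    rw [hz₂]
    funext i
    simp only [Pi.add_apply, Pi.smul_apply]
    ring
  rw [h2, ctBandFn_periodic, ctSurface]

section Grid

variable [NeZero L] [NeZero N] {β μ Λ : ℝ} {K : TrigPolyC4v}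

/-- **The padded symbol at a translated grid point samples `Ψ₁` along the surface** (time index not wrapping out of the window):
`G(q₀ + i u, q⃗ + j e_l + m e_{l'}) = (βL²)⁻²·βL²·Ψ₁(ω̃_{q₀} + i·2π/β, E(j·2π/L, m·2π/L))` for `val q₀ + i < 2M ≤ N`.
[cite: BenfattoGiulianiMastropietro2006, §2.1 (2.3)] -/
theorem gridSymbol_uvSymbolCT_translate (hβ : 0 < β) (hMN : 2 * M ≤ N) (σ : Fin 2) (q₀ : TorusSite 1 N) (qv : TorusSite 2 L)
    (l l' : Fin 2) (i j m : ℕ) (hi : (q₀ 0).val + i < 2 * M) :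
    gridSymbol L M N β (uvSymbolCT L M β μ K Λ) σ (q₀ + i • (fun _ : Fin 1 => (1 : ZMod N)))
        (qv + j • (Pi.single l (1 : ZMod L) : TorusSite 2 L) + m • (Pi.single l' (1 : ZMod L) : TorusSite 2 L)) =
      (((1 / (β * (L : ℝ) ^ 2) : ℝ) : ℂ) ^ 2 * ((β * (L : ℝ) ^ 2 : ℝ) : ℂ)) *
        uvSymbolOneFn Λ (gridFreq M N β q₀ + i * (2 * Real.pi / β),
          ctSurface μ K (latticeMomentum L qv) l l' (j * (2 * Real.pi / L)) (m * (2 * Real.pi / L))) := by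
  have hiN : (q₀ 0).val + i < N := by omega
  have hval : ((q₀ + i • (fun _ : Fin 1 => (1 : ZMod N))) 0).val < 2 * M := by
    rw [val_add_smul_timeStep q₀ (by omega), Nat.mod_eq_of_lt hiN]; exact hi
  rw [gridSymbol_uvSymbolCT_eq hβ, if_pos hval, gridFreq_add_smul β q₀ i hiN, uvSymbolFn_eq_mul_uvSymbolOneFn,
    nambuXiCT_add_smul_add_smul_eq_ctSurface]
  ring

/-- **In the interior the mixed grid differences are the mixed continuum differences**: for `val q₀ + a < 2M ≤ N`,
`Δ_u^a (Δ_{e_l}^b Δ_{e_{l'}}^c G(·, ·))(q₀)(q⃗) = (βL²)⁻²βL² · Δ_{2π/β}^a Δ_{2π/L}^b Δ_{2π/L}^c Ψ₁(ω, E(s,t))|_{(ω̃_{q₀},0,0)}`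
(`fwdDiff_iter_eq_smul_of_sample`, three times). [cite: BenfattoGiulianiMastropietro2006, Lemma 2.2] -/
theorem mixedDiff_gridSymbol_eq_interior (hβ : 0 < β) (hMN : 2 * M ≤ N) (σ : Fin 2) (q₀ : TorusSite 1 N) (qv : TorusSite 2 L)
    (l l' : Fin 2) (a b c : ℕ) (ha : (q₀ 0).val + a < 2 * M) :
    (fwdDiff (fun _ : Fin 1 => (1 : ZMod N)))^[a]
        (fun q => ((fwdDiff (Pi.single l (1 : ZMod L) : TorusSite 2 L))^[b]
          ((fwdDiff (Pi.single l' (1 : ZMod L) : TorusSite 2 L))^[c] (gridSymbol L M N β (uvSymbolCT L M β μ K Λ) σ q))) qv) q₀ =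
      (((1 / (β * (L : ℝ) ^ 2) : ℝ) : ℂ) ^ 2 * ((β * (L : ℝ) ^ 2 : ℝ) : ℂ)) •
        (fwdDiff (2 * Real.pi / β))^[a] (fun ω => (fwdDiff (2 * Real.pi / L))^[b]
          (fun s => (fwdDiff (2 * Real.pi / L))^[c]
            (fun t => uvSymbolOneFn Λ (ω, ctSurface μ K (latticeMomentum L qv) l l' s t)) 0) 0) (gridFreq M N β q₀) := by
  set Kc : ℂ := ((1 / (β * (L : ℝ) ^ 2) : ℝ) : ℂ) ^ 2 * ((β * (L : ℝ) ^ 2 : ℝ) : ℂ) with hKc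
  refine Literature.Analysis.fwdDiff_iter_eq_smul_of_sample (fun i hi => ?_)
  refine Literature.Analysis.fwdDiff_iter_eq_smul_of_sample (fun j _ => ?_)
  refine Literature.Analysis.fwdDiff_iter_eq_smul_of_sample (fun m _ => ?_)
  simpa only [nsmul_eq_mul, smul_eq_mul, zero_add] using gridSymbol_uvSymbolCT_translate hβ hMN σ q₀ qv l l' i j m (by omega)

/-- **Interior bound**: under `UVSurfaceBound μ K D`, for `val q₀ + a < 2M ≤ N`, `b, c ≤ 1`,
`‖Δ_u^a (Δ_{e_l}^b Δ_{e_{l'}}^c G)(q₀)(q⃗)‖ ≤ (βL²)⁻¹·(2π/β)^a(2π/L)^{b+c}·S_{a,b+c}(Λ,D)/max(|ω̃_{q₀}| - a·2π/β, Λ/2)^{a+min(b+c,1)+1}`.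
[cite: BenfattoGiulianiMastropietro2006, (2.36aa)] -/
theorem norm_mixedDiff_gridSymbol_le_interior (hβ : 0 < β) (hΛ : 0 < Λ) {D : ℝ} (hD : 0 ≤ D) (hsurf : UVSurfaceBound μ K D)
    (hMN : 2 * M ≤ N) (σ : Fin 2) (q₀ : TorusSite 1 N) (qv : TorusSite 2 L) (l l' : Fin 2) (a : ℕ) {b c : ℕ} (hb : b ≤ 1)
    (hc : c ≤ 1) (ha : (q₀ 0).val + a < 2 * M) :
    ‖(fwdDiff (fun _ : Fin 1 => (1 : ZMod N)))^[a]
        (fun q => ((fwdDiff (Pi.single l (1 : ZMod L) : TorusSite 2 L))^[b]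
          ((fwdDiff (Pi.single l' (1 : ZMod L) : TorusSite 2 L))^[c] (gridSymbol L M N β (uvSymbolCT L M β μ K Λ) σ q))) qv) q₀‖ ≤
      1 / (β * (L : ℝ) ^ 2) * ((2 * Real.pi / β) ^ a * (2 * Real.pi / L) ^ (b + c) *
        (uvSurfaceConst Λ D a (b + c) / max (|gridFreq M N β q₀| - a * (2 * Real.pi / β)) (Λ / 2) ^ (a + min (b + c) 1 + 1))) := by
  have hL : (0 : ℝ) < L := by exact_mod_cast Nat.pos_of_ne_zero (NeZero.ne L)
  have hc0 : 0 < β * (L : ℝ) ^ 2 := by positivity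
  obtain ⟨Es, Et, Est, hEs, hEt, hEst, hbd⟩ := hsurf (latticeMomentum L qv) l l'
  rw [mixedDiff_gridSymbol_eq_interior hβ hMN σ q₀ qv l l' a b c ha, norm_smul]
  have hK : ‖((1 / (β * (L : ℝ) ^ 2) : ℝ) : ℂ) ^ 2 * ((β * (L : ℝ) ^ 2 : ℝ) : ℂ)‖ = 1 / (β * (L : ℝ) ^ 2) := by
    rw [norm_mul, norm_pow, Complex.norm_real, Complex.norm_real, Real.norm_eq_abs, Real.norm_eq_abs,
      abs_of_nonneg (by positivity), abs_of_nonneg hc0.le]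
    field_simp
  rw [hK]
  exact mul_le_mul_of_nonneg_left (norm_mixedDiff_uvSymbolOneFn_le hΛ hD hEs hEt hEst (fun s t => (hbd s t).1)
    (fun s t => (hbd s t).2.1) (fun s t => (hbd s t).2.2) a hb hc (by positivity) (by positivity) _) (by positivity)

/-- **In the padding all samples vanish**: for `2M ≤ val q₀` and `val q₀ + a < N` every time translate lies beyond the window, so the
mixed difference is `0`. [cite: BenfattoGiulianiMastropietro2006, (2.36aa)] -/
theorem mixedDiff_gridSymbol_eq_zero_of_padding (σ : Fin 2) (q₀ : TorusSite 1 N) (qv : TorusSite 2 L) (l l' : Fin 2) (a b c : ℕ)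
    (h1 : 2 * M ≤ (q₀ 0).val) (h2 : (q₀ 0).val + a < N) :
    (fwdDiff (fun _ : Fin 1 => (1 : ZMod N)))^[a]
        (fun q => ((fwdDiff (Pi.single l (1 : ZMod L) : TorusSite 2 L))^[b]
          ((fwdDiff (Pi.single l' (1 : ZMod L) : TorusSite 2 L))^[c] (gridSymbol L M N β (uvSymbolCT L M β μ K Λ) σ q))) qv) q₀ = 0 := by
  rw [fwdDiff_iter_eq_sum_shift]
  refine sum_eq_zero fun i hi => ?_
  have hi' : i ≤ a := Nat.lt_succ_iff.1 (mem_range.1 hi)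
  have hzero : gridSymbol L M N β (uvSymbolCT L M β μ K Λ) σ (q₀ + i • (fun _ : Fin 1 => (1 : ZMod N))) = 0 := by
    funext q
    have hv : ¬ ((q₀ + i • (fun _ : Fin 1 => (1 : ZMod N))) 0).val < 2 * M := by
      rw [val_add_smul_timeStep q₀ (by omega), Nat.mod_eq_of_lt (by omega)]; omega
    unfold gridSymbol
    rw [dif_neg hv, Pi.zero_apply]
  simp only [hzero]
  rw [fwdDiff_iter_zero', fwdDiff_iter_zero']
  simp
where
  /-- Iterated differences of the zero function vanish. [folklore] -/
  fwdDiff_iter_zero' {v : TorusSite 2 L} {n : ℕ} : (fwdDiff v)^[n] (0 : TorusSite 2 L → ℂ) = 0 := by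
    induction n with
    | zero => rfl
    | succ n ih => rw [Function.iterate_succ_apply', ih]; funext x; simp [fwdDiff]

omit [NeZero L] [NeZero N] in
/-- **Extreme frequencies**: an index `≤ a - 1` or `≥ 2M - a` (below `2M`) has `|ω̃| ≥ π(2M - 2a + 1)/β`. [cite: Salmhofer1999, §4.2.4 (4.63)] -/
theorem abs_gridFreq_ge_of_extreme (hβ : 0 < β) (q₀ : TorusSite 1 N) {a : ℕ}
    (h : (q₀ 0).val + 1 ≤ a ∨ 2 * M ≤ (q₀ 0).val + a) :
    Real.pi * (2 * M - 2 * a + 1) / β ≤ |gridFreq M N β q₀| := by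
  unfold gridFreq
  rw [abs_div, abs_of_pos hβ, abs_mul, abs_of_pos Real.pi_pos]
  refine div_le_div_of_nonneg_right (mul_le_mul_of_nonneg_left ?_ Real.pi_pos.le) hβ.le
  rcases h with h | h
  · have hv : ((q₀ 0).val : ℝ) + 1 ≤ a := by exact_mod_cast h
    rw [le_abs]; right; linarith
  · have hv : (2 * M : ℝ) ≤ ((q₀ 0).val : ℝ) + a := by exact_mod_cast h
    rw [le_abs]; left; linarith

/-- **The value bound at an extreme frequency** (time order `0`): for `val q₀ + 1 ≤ a` or `2M - a ≤ val q₀`, and `a + 1 ≤ M`,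
`‖(Δ_{e_l}^b Δ_{e_{l'}}^c G(q₀,·))(q⃗)‖ ≤ (βL²)⁻¹(2π/L)^{b+c}·S_{0,b+c}/max(π(2M-2a+1)/β, Λ/2)^{min(b+c,1)+1}` (zero beyond the window).
[cite: BenfattoGiulianiMastropietro2006, (2.36aa)] -/
theorem norm_spaceDiff_gridSymbol_le_extreme (hβ : 0 < β) (hΛ : 0 < Λ) {D : ℝ} (hD : 0 ≤ D) (hsurf : UVSurfaceBound μ K D)
    (hMN : 2 * M ≤ N) (σ : Fin 2) (q₀ : TorusSite 1 N) (qv : TorusSite 2 L) (l l' : Fin 2) {a b c : ℕ} (hb : b ≤ 1) (hc : c ≤ 1)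
    (haM : a + 1 ≤ M) (hq : (q₀ 0).val + 1 ≤ a ∨ 2 * M ≤ (q₀ 0).val + a) :
    ‖((fwdDiff (Pi.single l (1 : ZMod L) : TorusSite 2 L))^[b]
        ((fwdDiff (Pi.single l' (1 : ZMod L) : TorusSite 2 L))^[c] (gridSymbol L M N β (uvSymbolCT L M β μ K Λ) σ q₀))) qv‖ ≤
      1 / (β * (L : ℝ) ^ 2) * ((2 * Real.pi / L) ^ (b + c) *
        (uvSurfaceConst Λ D 0 (b + c) / max (Real.pi * (2 * M - 2 * a + 1) / β) (Λ / 2) ^ (min (b + c) 1 + 1))) := by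
  have hL : (0 : ℝ) < L := by exact_mod_cast Nat.pos_of_ne_zero (NeZero.ne L)
  have hS := uvSurfaceConst_nonneg hΛ hD 0 (b + c)
  have hΩ : 0 < Real.pi * (2 * M - 2 * a + 1) / β := by
    have : (a : ℝ) + 1 ≤ M := by exact_mod_cast haM
    have : (0 : ℝ) < 2 * M - 2 * a + 1 := by linarith
    positivity
  have hmx : 0 < max (Real.pi * (2 * M - 2 * a + 1) / β) (Λ / 2) := lt_max_of_lt_right (by positivity)
  by_cases hin : (q₀ 0).val < 2 * M
  · -- time order `0` interior bound at `q₀`, then the frequency is extreme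
    have h0 := norm_mixedDiff_gridSymbol_le_interior hβ hΛ hD hsurf hMN σ q₀ qv l l' 0 hb hc (by simpa using hin)
    simp only [Function.iterate_zero, id_eq, pow_zero, one_mul, Nat.cast_zero, zero_mul, sub_zero, zero_add] at h0
    refine h0.trans (mul_le_mul_of_nonneg_left (mul_le_mul_of_nonneg_left ?_ (by positivity)) (by positivity))
    have hfr := abs_gridFreq_ge_of_extreme (M := M) hβ q₀ hq
    exact div_le_div_of_nonneg_left hS (pow_pos hmx _) (pow_le_pow_left₀ hmx.le (max_le_max hfr le_rfl) _)
  · -- beyond the window the row vanishes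
    have hzero : gridSymbol L M N β (uvSymbolCT L M β μ K Λ) σ q₀ = 0 := by
      funext q; unfold gridSymbol; rw [dif_neg hin]; rfl
    rw [hzero, mixedDiff_gridSymbol_eq_zero_of_padding.fwdDiff_iter_zero', mixedDiff_gridSymbol_eq_zero_of_padding.fwdDiff_iter_zero']
    simp only [Pi.zero_apply, norm_zero]
    positivity

/-- **The non-interior, non-padding differences are edge-sized**: for `2M ≤ val q₀ + a` every sample `q₀ + i u` (`i ≤ a`) is beyond the
window or at an extreme frequency, so `‖Δ_u^a(Δ_{e_l}^bΔ_{e_{l'}}^c G)(q₀)(q⃗)‖ ≤ 2^a·[extreme value bound]` (`a + 1 ≤ M`, `2M ≤ N`).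
[cite: BenfattoGiulianiMastropietro2006, (2.36aa)] -/
theorem norm_mixedDiff_gridSymbol_le_edge (hβ : 0 < β) (hΛ : 0 < Λ) {D : ℝ} (hD : 0 ≤ D) (hsurf : UVSurfaceBound μ K D)
    (hMN : 2 * M ≤ N) (σ : Fin 2) (q₀ : TorusSite 1 N) (qv : TorusSite 2 L) (l l' : Fin 2) {a b c : ℕ} (hb : b ≤ 1) (hc : c ≤ 1)
    (haM : a + 1 ≤ M) (hq : 2 * M ≤ (q₀ 0).val + a) :
    ‖(fwdDiff (fun _ : Fin 1 => (1 : ZMod N)))^[a]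
        (fun q => ((fwdDiff (Pi.single l (1 : ZMod L) : TorusSite 2 L))^[b]
          ((fwdDiff (Pi.single l' (1 : ZMod L) : TorusSite 2 L))^[c] (gridSymbol L M N β (uvSymbolCT L M β μ K Λ) σ q))) qv) q₀‖ ≤
      2 ^ a * (1 / (β * (L : ℝ) ^ 2) * ((2 * Real.pi / L) ^ (b + c) *
        (uvSurfaceConst Λ D 0 (b + c) / max (Real.pi * (2 * M - 2 * a + 1) / β) (Λ / 2) ^ (min (b + c) 1 + 1)))) := by
  set V := 1 / (β * (L : ℝ) ^ 2) * ((2 * Real.pi / L) ^ (b + c) *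
    (uvSurfaceConst Λ D 0 (b + c) / max (Real.pi * (2 * M - 2 * a + 1) / β) (Λ / 2) ^ (min (b + c) 1 + 1))) with hV
  -- every sample point is extreme (or beyond the window)
  have hext : ∀ i ≤ a, ((q₀ + i • (fun _ : Fin 1 => (1 : ZMod N))) 0).val + 1 ≤ a ∨
      2 * M ≤ ((q₀ + i • (fun _ : Fin 1 => (1 : ZMod N))) 0).val + a := by
    intro i hi
    have hiN : i < N := by omega
    have hv := (q₀ 0).val_lt
    rw [val_add_smul_timeStep q₀ hiN]
    by_cases hlt : (q₀ 0).val + i < N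
    · rw [Nat.mod_eq_of_lt hlt]; right; omega
    · left
      rw [not_lt] at hlt
      have : ((q₀ 0).val + i) % N = (q₀ 0).val + i - N := by
        rw [Nat.mod_eq_sub_mod hlt, Nat.mod_eq_of_lt (by omega)]
      rw [this]; omega
  have hpt : ∀ i ≤ a, ‖((fwdDiff (Pi.single l (1 : ZMod L) : TorusSite 2 L))^[b]
      ((fwdDiff (Pi.single l' (1 : ZMod L) : TorusSite 2 L))^[c]
        (gridSymbol L M N β (uvSymbolCT L M β μ K Λ) σ (q₀ + i • (fun _ : Fin 1 => (1 : ZMod N)))))) qv‖ ≤ V := fun i hi =>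
    norm_spaceDiff_gridSymbol_le_extreme hβ hΛ hD hsurf hMN σ _ qv l l' hb hc haM (hext i hi)
  rw [fwdDiff_iter_eq_sum_shift]
  refine (norm_sum_le _ _).trans ?_
  calc ∑ i ∈ range (a + 1), ‖((-1 : ℤ) ^ (a - i) * (a.choose i : ℤ)) •
          ((fwdDiff (Pi.single l (1 : ZMod L) : TorusSite 2 L))^[b]
            ((fwdDiff (Pi.single l' (1 : ZMod L) : TorusSite 2 L))^[c]
              (gridSymbol L M N β (uvSymbolCT L M β μ K Λ) σ (q₀ + i • (fun _ : Fin 1 => (1 : ZMod N)))))) qv‖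
        ≤ ∑ i ∈ range (a + 1), (a.choose i : ℝ) * V := by
          refine sum_le_sum fun i hi => ?_
          rw [norm_smul]
          refine mul_le_mul ?_ (hpt i (Nat.lt_succ_iff.1 (mem_range.1 hi))) (norm_nonneg _) (by positivity)
          rw [Int.norm_eq_abs, Int.cast_mul, abs_mul, Int.cast_pow, abs_pow]
          simp
    _ = 2 ^ a * V := by
          rw [← sum_mul]
          congr 1
          have := (Nat.sum_range_choose a)
          exact_mod_cast this

omit [NeZero L] in
/-- **The edge set of the time direction has at most `2a` points**: `{q₀ : 2M ≤ val q₀ + a, ¬(2M ≤ val q₀ ∧ val q₀ + a < N)}` injects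
by `val` into `[2M - a, 2M) ∪ [N - a, N)`. [cite: Salmhofer1999, §4.2.4 (4.63)] -/
theorem card_timeEdge_le (a : ℕ) :
    ((univ : Finset (TorusSite 1 N)).filter fun q₀ =>
        2 * M ≤ (q₀ 0).val + a ∧ ¬ (2 * M ≤ (q₀ 0).val ∧ (q₀ 0).val + a < N)).card ≤ 2 * a := by
  classical
  set E := (univ : Finset (TorusSite 1 N)).filter fun q₀ =>
    2 * M ≤ (q₀ 0).val + a ∧ ¬ (2 * M ≤ (q₀ 0).val ∧ (q₀ 0).val + a < N) with hE
  have hinj : Set.InjOn (fun q₀ : TorusSite 1 N => (q₀ 0).val) E := fun q _ q' _ h =>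
    torusSite_one_ext (ZMod.val_injective _ h)
  have hsub : E.image (fun q₀ : TorusSite 1 N => (q₀ 0).val) ⊆ Finset.Ico (2 * M - a) (2 * M) ∪ Finset.Ico (N - a) N := by
    intro v hv
    obtain ⟨q₀, hq₀, rfl⟩ := mem_image.1 hv
    have h1 := (mem_filter.1 hq₀).2
    have hlt := (q₀ 0).val_lt
    simp only [mem_union, Finset.mem_Ico]
    omega
  calc E.card = (E.image fun q₀ : TorusSite 1 N => (q₀ 0).val).card := (card_image_of_injOn hinj).symm
    _ ≤ (Finset.Ico (2 * M - a) (2 * M) ∪ Finset.Ico (N - a) N).card := card_le_card hsub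
    _ ≤ (Finset.Ico (2 * M - a) (2 * M)).card + (Finset.Ico (N - a) N).card := card_union_le _ _
    _ ≤ a + a := by rw [Nat.card_Ico, Nat.card_Ico]; omega
    _ = 2 * a := by ring

end Grid

/-! ### The `ℓ²` sum -/

section Sums

variable [NeZero L] [NeZero N] {β μ Λ : ℝ} {K : TrigPolyC4v}

omit [NeZero N] in
/-- The number of torus momenta: `#(ℤ/L)² = L²`. [cite: BenfattoGiulianiMastropietro2006, §2.1 (2.1)] -/
private theorem card_torusSite_two'' : Fintype.card (TorusSite 2 L) = L ^ 2 := by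
  rw [Fintype.card_fun, ZMod.card, Fintype.card_fin]

/-- **The `ℓ²` norm of the mixed differences `Δ_u^a Δ_{e_l}^b Δ_{e_{l'}}^c` of the padded ultraviolet symbol** (`0 < β`, `0 < Λ`,
`UVSurfaceBound μ K D`, `a + 1 ≤ M`, `2M ≤ N`, `b, c ≤ 1`; `n := a + min(b+c,1) + 1`): the interior Matsubara sum
`L²·[(βL²)⁻¹(2π/β)^a(2π/L)^{b+c}S_{a,b+c}]²·(4ⁿ(2/Λ)^{2n-2}·2β/Λ + 4a(2/Λ)^{2n})` plus the `≤ 2a` edge rows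
`2a·L²·(2^a·(βL²)⁻¹(2π/L)^{b+c}S_{0,b+c}/max(π(2M-2a+1)/β, Λ/2)^{min(b+c,1)+1})²` — in the shape of the right-hand side of
`TorusFourierWeightedL1Mixed.sum_sum_mixedWeight_mul_norm_sq_le`. [cite: BenfattoGiulianiMastropietro2006, Lemma 2.2 and (2.36aa)] -/
theorem sum_norm_sq_mixedDiff_uvSymbolCT_le (hβ : 0 < β) (hΛ : 0 < Λ) {D : ℝ} (hD : 0 ≤ D) (hsurf : UVSurfaceBound μ K D)
    {a : ℕ} (haM : a + 1 ≤ M) (hMN : 2 * M ≤ N) (σ : Fin 2) (l l' : Fin 2) {b c : ℕ} (hb : b ≤ 1) (hc : c ≤ 1) :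
    ∑ q₀ : TorusSite 1 N, ∑ qv : TorusSite 2 L,
        ‖(fwdDiff (fun _ : Fin 1 => (1 : ZMod N)))^[a]
          (fun q => ((fwdDiff (Pi.single l (1 : ZMod L) : TorusSite 2 L))^[b]
            ((fwdDiff (Pi.single l' (1 : ZMod L) : TorusSite 2 L))^[c]
              (gridSymbol L M N β (uvSymbolCT L M β μ K Λ) σ q))) qv) q₀‖ ^ 2 ≤
      (L : ℝ) ^ 2 * ((1 / (β * (L : ℝ) ^ 2) * ((2 * Real.pi / β) ^ a * (2 * Real.pi / L) ^ (b + c) *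
          uvSurfaceConst Λ D a (b + c))) ^ 2 *
        (4 ^ (a + min (b + c) 1 + 1) * ((2 / Λ) ^ (2 * (a + min (b + c) 1 + 1) - 2) * (2 * β / Λ)) +
          4 * a * (2 / Λ) ^ (2 * (a + min (b + c) 1 + 1)))) +
      2 * a * ((L : ℝ) ^ 2 * (2 ^ a * (1 / (β * (L : ℝ) ^ 2) * ((2 * Real.pi / L) ^ (b + c) *
          (uvSurfaceConst Λ D 0 (b + c) / max (Real.pi * (2 * M - 2 * a + 1) / β) (Λ / 2) ^ (min (b + c) 1 + 1))))) ^ 2) := by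
  classical
  set n := a + min (b + c) 1 + 1 with hn
  set A : ℝ := 1 / (β * (L : ℝ) ^ 2) * ((2 * Real.pi / β) ^ a * (2 * Real.pi / L) ^ (b + c) * uvSurfaceConst Λ D a (b + c))
    with hA
  set Eb : ℝ := 2 ^ a * (1 / (β * (L : ℝ) ^ 2) * ((2 * Real.pi / L) ^ (b + c) *
    (uvSurfaceConst Λ D 0 (b + c) / max (Real.pi * (2 * M - 2 * a + 1) / β) (Λ / 2) ^ (min (b + c) 1 + 1)))) with hEb
  set Edge := (univ : Finset (TorusSite 1 N)).filter fun q₀ =>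
    2 * M ≤ (q₀ 0).val + a ∧ ¬ (2 * M ≤ (q₀ 0).val ∧ (q₀ 0).val + a < N) with hEdge
  set F : TorusSite 1 N → TorusSite 2 L → ℂ := fun q₀ qv =>
    (fwdDiff (fun _ : Fin 1 => (1 : ZMod N)))^[a]
      (fun q => ((fwdDiff (Pi.single l (1 : ZMod L) : TorusSite 2 L))^[b]
        ((fwdDiff (Pi.single l' (1 : ZMod L) : TorusSite 2 L))^[c] (gridSymbol L M N β (uvSymbolCT L M β μ K Λ) σ q))) qv) q₀
    with hF
  have hL : (0 : ℝ) < L := by exact_mod_cast Nat.pos_of_ne_zero (NeZero.ne L)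
  have hS := uvSurfaceConst_nonneg hΛ hD a (b + c)
  have hA0 : 0 ≤ A := by positivity
  -- pointwise: interior envelope + edge indicator
  have hpt : ∀ (q₀ : TorusSite 1 N) (qv : TorusSite 2 L), ‖F q₀ qv‖ ^ 2 ≤
      (if (q₀ 0).val < 2 * M then A ^ 2 * (1 / max (|gridFreq M N β q₀| - a * (2 * Real.pi / β)) (Λ / 2) ^ (2 * n)) else 0) +
        (if q₀ ∈ Edge then Eb ^ 2 else 0) := by
    intro q₀ qv
    have hms : 0 < max (|gridFreq M N β q₀| - a * (2 * Real.pi / β)) (Λ / 2) := lt_max_of_lt_right (by positivity)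
    by_cases hint : (q₀ 0).val + a < 2 * M
    · have h := norm_mixedDiff_gridSymbol_le_interior hβ hΛ hD hsurf hMN σ q₀ qv l l' a hb hc hint
      rw [if_pos (show (q₀ 0).val < 2 * M by omega)]
      refine le_add_of_le_of_nonneg ((pow_le_pow_left₀ (norm_nonneg _) h 2).trans (le_of_eq ?_)) (by split_ifs <;> positivity)
      rw [hA, hn]
      field_simp
      ring
    · by_cases hpad : 2 * M ≤ (q₀ 0).val ∧ (q₀ 0).val + a < N
      · have h0 := mixedDiff_gridSymbol_eq_zero_of_padding (β := β) (μ := μ) (K := K) (Λ := Λ) (M := M) σ q₀ qv l l' a b c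
          hpad.1 hpad.2
        rw [hF]; dsimp only; rw [h0, norm_zero, zero_pow two_ne_zero]
        exact add_nonneg (by split_ifs <;> positivity) (by split_ifs <;> positivity)
      · have hmem : q₀ ∈ Edge := mem_filter.2 ⟨mem_univ _, by omega, hpad⟩
        have h := norm_mixedDiff_gridSymbol_le_edge hβ hΛ hD hsurf hMN σ q₀ qv l l' hb hc haM (by omega)
        rw [if_pos hmem]
        refine le_add_of_nonneg_of_le (by split_ifs <;> positivity) ?_
        rw [hEb]
        exact pow_le_pow_left₀ (norm_nonneg _) h 2
  refine (sum_le_sum fun q₀ _ => sum_le_sum fun qv _ => hpt q₀ qv).trans ?_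
  simp only [sum_add_distrib]
  refine add_le_add ?_ ?_
  · rw [sum_sum_window_eq hMN β (fun ω => A ^ 2 * (1 / max (|ω| - a * (2 * Real.pi / β)) (Λ / 2) ^ (2 * n))), ← mul_sum,
      hA]
    exact mul_le_mul_of_nonneg_left (mul_le_mul_of_nonneg_left (sum_inv_uvEnvShift_pow_le hβ hΛ M a (by omega))
      (by positivity)) (by positivity)
  · -- the edge: at most `2a` points, each a row of `L²` momenta
    have hrow : ∀ q₀ : TorusSite 1 N, ∑ _qv : TorusSite 2 L, (if q₀ ∈ Edge then Eb ^ 2 else (0 : ℝ)) =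
        if q₀ ∈ Edge then (L : ℝ) ^ 2 * Eb ^ 2 else 0 := by
      intro q₀
      split_ifs
      · rw [sum_const, card_univ, card_torusSite_two'', nsmul_eq_mul, Nat.cast_pow]
      · simp
    simp_rw [hrow]
    rw [← sum_filter, Finset.filter_mem_eq_inter, Finset.univ_inter, sum_const, nsmul_eq_mul]
    have hcard : (Edge.card : ℝ) ≤ 2 * a := by exact_mod_cast card_timeEdge_le (M := M) (N := N) a
    have : (0 : ℝ) ≤ (L : ℝ) ^ 2 * Eb ^ 2 := by positivity
    calc (Edge.card : ℝ) * ((L : ℝ) ^ 2 * Eb ^ 2) ≤ (2 * a) * ((L : ℝ) ^ 2 * Eb ^ 2) := mul_le_mul_of_nonneg_right hcard this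
      _ = _ := by rw [hEb]

end Sums

end Literature.MathematicalPhysics.QuantumLattice

end
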